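import Mathlib

/-!
# P7Certificate — the finite arithmetic behind the dimension-6 witness (proofs/p7-minimal-instances.md, Prop. 4.1)

Setting (paper side, not formalised): `L = ℚ(ζ₁₅)` with `Gal(L/ℚ) = (ℤ/15)ˣ`, complex conjugation `= 14 = -1`;
`M = ℚ(ζ₅) = L^{⟨11⟩}` with `Gal(M/ℚ) = (ℤ/5)ˣ`, restriction `a ↦ a mod 5`.
`B₁` = simple CM abelian surface with CM by `M`, CM type `Φ₁ = {1, 2}`;
`B₂` = simple CM abelian fourfold with CM by `L`, CM type `Φ₂ = {1, 2, 4, 7}`.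
The subset `Δ = ({1,2} ⊂ Hom(M,ℂ)) ⊔ ({8,13} ⊂ Hom(L,ℂ))` indexes the class
`e_Δ = e₁ ∧ e₂ ∧ e₈ ∧ e₁₃ ∈ H²(B₁) ⊗ H²(B₂) ⊂ H⁴(B₁ × B₂)`.

What is certified here (everything is a finite computation, proved by `decide`, standard axioms only):
* `cmType₁`, `cmType₂`: `Φ₁`, `Φ₂` are CM types (exactly one of `x, -x` in the type);
* `primitive₂`: `Φ₂` is primitive (its right stabiliser is trivial), so `B₂` is simple with `End⁰ = L`;
* `Δ_hodge`: the balance condition `|Δ₁ ∩ τΦ₁| + |Δ₂ ∩ τΦ₂| = |Δ|/2` for all `τ` — by the CM-type description of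
  Hodge classes (Pohlmann; p8 (C1)) this says `e_Δ` is a Hodge class (of type (2,2));
* `orbit_card`, `stab`: the Galois orbit of `Δ` has 4 elements and stabiliser `{1, 11} = Gal(L/M)`;
  so the orbit field of P5 §10 is `K_O = M`, of degree 4;
* `no_hodge_pair`: no 2-element subset of `Δ` is balanced — `Δ` is not pair-decomposable (not a product of divisor classes);
* the certificate: `χ` is the character of `(ℤ/15)ˣ` of order 4 with `χ(2) = i`, `χ(11) = 1` (so `χ(14) = -1`, `χ` is odd);
  `χ_sum_Δ₁`: its sum over `Δ₁` is `1 + i ≠ 0`, while (`χ_pair`) it sums to `0` over every conjugate pair `{x, -x}`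
  and (`χ_coset`) over every coset `yH` of every index-2 subgroup `H` of `(ℤ/15)ˣ` not containing `14`.
  By Lemma 2.2 of the paper file these are the characters of all divisor classes and of all imaginary-quadratic Weil
  classes on all powers of `B₁ × B₂`; hence the orbit piece of `e_Δ` is not in the algebra they generate (Cor. 2.3).

Nothing about abelian varieties or Hodge classes is formalised; the passage from these finite statements to Prop. 4.1
is the paper argument. The file exists so that the arithmetic of the witness is kernel-checked.
-/

namespace HodgeRepro0.P7Certificate

open Finset

/-- The unit group of `ℤ/15`, as an explicit finset: `Gal(ℚ(ζ₁₅)/ℚ)`. -/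
def U15 : Finset (ZMod 15) := {1, 2, 4, 7, 8, 11, 13, 14}

/-- The unit group of `ℤ/5`: `Gal(ℚ(ζ₅)/ℚ)`. -/
def U5 : Finset (ZMod 5) := {1, 2, 3, 4}

/-- Restriction `Gal(L/ℚ) → Gal(M/ℚ)`, `a mod 15 ↦ a mod 5`. -/
def res (a : ZMod 15) : ZMod 5 := (a.val : ZMod 5)

/-- The CM type of the surface `B₁` (a subset of `Gal(M/ℚ)`). -/
def Φ₁ : Finset (ZMod 5) := {1, 2}

/-- The CM type of the fourfold `B₂` (a subset of `Gal(L/ℚ)`). -/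
def Φ₂ : Finset (ZMod 15) := {1, 2, 4, 7}

/-- The `B₁`-part of `Δ`. -/
def Δ₁ : Finset (ZMod 5) := {1, 2}

/-- The `B₂`-part of `Δ`. -/
def Δ₂ : Finset (ZMod 15) := {8, 13}

/-- `U15` is closed under multiplication (it is the unit group). -/
theorem U15_mul : ∀ a ∈ U15, ∀ b ∈ U15, a * b ∈ U15 := by decide

/-- `res` is multiplicative on units. -/
theorem res_mul : ∀ a ∈ U15, ∀ b ∈ U15, res (a * b) = res a * res b := by decide

/-- `Φ₁` is a CM type: exactly one of `x`, `-x` lies in it. -/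
theorem cmType₁ : ∀ x ∈ U5, (x ∈ Φ₁ ↔ -x ∉ Φ₁) := by decide

/-- `Φ₂` is a CM type. -/
theorem cmType₂ : ∀ x ∈ U15, (x ∈ Φ₂ ↔ -x ∉ Φ₂) := by decide

/-- `Φ₂` is primitive: the only `h` with `Φ₂ · h = Φ₂` is `h = 1`. -/
theorem primitive₂ : ∀ h ∈ U15, Φ₂.image (· * h) = Φ₂ → h = 1 := by decide

/-- `Φ₁` is primitive. -/
theorem primitive₁ : ∀ h ∈ U5, Φ₁.image (· * h) = Φ₁ → h = 1 := by decide

/-- Points of the disjoint union `Hom(M,ℂ) ⊔ Hom(L,ℂ)`. -/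
abbrev Pt := ZMod 5 ⊕ ZMod 15

/-- Is the point in the `τ`-translate of the CM type (of its factor)? -/
def inTauPhi (τ : ZMod 15) : Pt → Bool
  | Sum.inl x => decide (x ∈ Φ₁.image (· * res τ))
  | Sum.inr y => decide (y ∈ Φ₂.image (· * τ))

/-- `|S ∩ τΦ|` for a subset `S` of the disjoint union. -/
def cnt (S : Finset Pt) (τ : ZMod 15) : ℕ := (S.filter (fun z => inTauPhi τ z = true)).card

/-- The balance condition: `S` indexes Hodge classes iff `2 |S ∩ τΦ| = |S|` for every `τ ∈ Gal(L/ℚ)`. -/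
def IsHodgeSet (S : Finset Pt) : Prop := ∀ τ ∈ U15, 2 * cnt S τ = S.card

/-- The balance condition is decidable (a finite conjunction over `U15`). -/
instance (S : Finset Pt) : Decidable (IsHodgeSet S) := by unfold IsHodgeSet; infer_instance

/-- The witness `Δ = {1, 2} ⊔ {8, 13}`. -/
def Δ : Finset Pt := {Sum.inl 1, Sum.inl 2, Sum.inr 8, Sum.inr 13}

/-- `Δ` satisfies the balance condition: `e_Δ` is a Hodge class (the 8-row table of Prop. 4.1(a)). -/
theorem Δ_hodge : IsHodgeSet Δ := by decide

/-- Row `τ = 1` of the table: `Δ₁ ⊂ Φ₁` and `Δ₂ ∩ Φ₂ = ∅`, i.e. `e_Δ ∈ H^{2,0}(B₁) ⊗ H^{0,2}(B₂)`. -/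
theorem Δ_type : (Δ₁ ∩ Φ₁).card = 2 ∧ (Δ₂ ∩ Φ₂).card = 0 := by decide

/-- The Galois orbit of `Δ` (as a pair of finsets) has exactly 4 elements. -/
theorem orbit_card :
    (U15.image (fun τ => (Δ₁.image (· * res τ), Δ₂.image (· * τ)))).card = 4 := by decide

/-- The stabiliser of `Δ` in `Gal(L/ℚ)` is `{1, 11} = Gal(L/M)`. -/
theorem stab :
    U15.filter (fun τ => Δ₁.image (· * res τ) = Δ₁ ∧ Δ₂.image (· * τ) = Δ₂) = {1, 11} := by decide

/-- No 2-element subset of `Δ` is balanced: `Δ` is not pair-decomposable. -/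
theorem no_hodge_pair' : ∀ a ∈ Δ, ∀ b ∈ Δ, a ≠ b → ¬ IsHodgeSet {a, b} := by decide

/-- The same, stated for all 2-element subsets of `Δ`. -/
theorem no_hodge_pair : ∀ P ∈ Δ.powerset, P.card = 2 → ¬ IsHodgeSet P := by
  intro P hP hcard
  rw [Finset.mem_powerset] at hP
  obtain ⟨a, b, hab, rfl⟩ := Finset.card_eq_two.mp hcard
  have ha : a ∈ Δ := hP (by simp)
  have hb : b ∈ Δ := hP (by simp)
  exact no_hodge_pair' a ha b hb hab

/-- The character `χ` of `Gal(M/ℚ) = (ℤ/5)ˣ` with `χ(2) = i`, as a function into the Gaussian integers. -/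
def χ5 (x : ZMod 5) : GaussianInt :=
  if x = 1 then 1 else if x = 2 then ⟨0, 1⟩ else if x = 4 then -1 else if x = 3 then ⟨0, -1⟩ else 0

/-- `χ` pulled back to `Gal(L/ℚ)`; it is trivial on `Gal(L/M) = {1, 11}`. -/
def χ (a : ZMod 15) : GaussianInt := χ5 (res a)

/-- `χ` is multiplicative on `(ℤ/5)ˣ`. -/
theorem χ5_mul : ∀ a ∈ U5, ∀ b ∈ U5, χ5 (a * b) = χ5 a * χ5 b := by decide

/-- `χ` is odd: `χ(-1) = -1`; and it has order 4 (`χ(2)² = -1`). -/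
theorem χ_odd : χ 14 = -1 ∧ χ 2 * χ 2 = -1 ∧ χ 11 = 1 := by decide

/-- The certificate value: `Σ_{x ∈ Δ₁} χ(x) = 1 + i ≠ 0`. -/
theorem χ_sum_Δ₁ : Δ₁.sum χ5 = ⟨1, 1⟩ ∧ Δ₁.sum χ5 ≠ 0 := by decide

/-- `χ` sums to zero over every conjugate pair `{x, -x}` (characters of divisor classes). -/
theorem χ_pair : ∀ x ∈ U5, χ5 x + χ5 (-x) = 0 := by decide

/-- There are exactly two index-2 subgroups of `(ℤ/15)ˣ` not containing `14`: `{1,2,4,8}` and `{1,4,7,13}`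
(the fixed fields are the two imaginary quadratic subfields `ℚ(√-15)`, `ℚ(√-3)` of `L`; neither lies in `M`). -/
theorem index2_subgroups :
    U15.powerset.filter (fun H => H.card = 4 ∧ (∀ a ∈ H, ∀ b ∈ H, a * b ∈ H) ∧ (14 : ZMod 15) ∉ H)
      = {({1, 2, 4, 8} : Finset (ZMod 15)), {1, 4, 7, 13}} := by decide

/-- `χ` sums to zero over every coset `yH` of each of the two subgroups. -/
theorem χ_coset' :
    ∀ H ∈ ({({1, 2, 4, 8} : Finset (ZMod 15)), {1, 4, 7, 13}} : Finset (Finset (ZMod 15))),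
      ∀ y ∈ U15, (H.image (· * y)).sum χ = 0 := by decide +kernel

/-- `χ` sums to zero over every coset `yH` of every index-2 subgroup `H` of `(ℤ/15)ˣ` not containing `14`
(characters of imaginary-quadratic Weil classes, Lemma 2.2(b)). -/
theorem χ_coset :
    ∀ H ∈ U15.powerset, H.card = 4 → (∀ a ∈ H, ∀ b ∈ H, a * b ∈ H) → (14 : ZMod 15) ∉ H →
      ∀ y ∈ U15, (H.image (· * y)).sum χ = 0 := by
  intro H hH hcard hmul h14
  have hmem : H ∈ U15.powerset.filter
      (fun H => H.card = 4 ∧ (∀ a ∈ H, ∀ b ∈ H, a * b ∈ H) ∧ (14 : ZMod 15) ∉ H) :=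
    Finset.mem_filter.mpr ⟨hH, hcard, hmul, h14⟩
  rw [index2_subgroups] at hmem
  exact χ_coset' H hmem

/-- The packaged certificate of Prop. 4.1 (a)–(c). -/
theorem certificate :
    IsHodgeSet Δ ∧
    (∀ P ∈ Δ.powerset, P.card = 2 → ¬ IsHodgeSet P) ∧
    Δ₁.sum χ5 ≠ 0 ∧
    (∀ x ∈ U5, χ5 x + χ5 (-x) = 0) ∧
    (∀ H ∈ U15.powerset, H.card = 4 → (∀ a ∈ H, ∀ b ∈ H, a * b ∈ H) → (14 : ZMod 15) ∉ H →
      ∀ y ∈ U15, (H.image (· * y)).sum χ = 0) :=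
  ⟨Δ_hodge, no_hodge_pair, χ_sum_Δ₁.2, χ_pair, χ_coset⟩

end HodgeRepro0.P7Certificate
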